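import Literature.RingTheory.Flat.LocalCriterion
import Mathlib.RingTheory.Localization.Free
import Mathlib.RingTheory.Flat.Localization
import Mathlib.RingTheory.Flat.Stability
import Mathlib.RingTheory.LocalRing.Module
import Mathlib.RingTheory.Localization.AtPrime.Basic
import Mathlib.RingTheory.Localization.Finiteness
import HarnessLib

/-!
# Formally free cokernel — the commutative algebra core

Helper file for stub ED (`stub_formallyFreeCokernel`) of line `chow-zariski-pushforward` of the crux
`PadicSemiregularLift.FormalVectorBundlesAlgebraize` (stmt-HodgeConjecture-14106): a finitely
presented module `N` over a Noetherian ring `B` all of whose truncations `N/π^{n+1}N` are flat over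
`B/π^{n+1}` is free on a basic open neighbourhood of every prime containing `π`
(Görtz–Wedhorn II, Prop. 24.95 / Stacks 0523 + 00NX; Matsumura, Thm. 22.3 (5) ⇒ (1)).

* `flat_of_flat_quotient_powers` — Matsumura's local flatness criterion in the form (5) ⇒ (1):
  for `R` Noetherian, `J` an ideal and `N` a `J`-adically ideal-separated `R`-module, if
  `N/J^{n+1}N` is flat over `R/J^{n+1}` for every `n` then `N` is flat over `R` (same Artin–Rees
  chase as `Literature.RingTheory.Flat.flat_of_iInf_pow_smul_eq_bot`, the injectivity of
  `N ⊗ (𝔞 + Jⁿ)/Jⁿ → N ⊗ R/Jⁿ` now coming from the flatness of `N/JⁿN`);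
* `flat_of_flat_quotient_powers_of_le_jacobson` — the same for a finite module and `J ⊆ rad R`
  (Krull's intersection theorem gives the separatedness);
* `exists_free_localizedModule_of_flat_quotient_powers` — for `B` Noetherian, `π ∈ B`, `N` finitely
  presented with `N/π^{n+1}N` flat over `B/π^{n+1}` for all `n`, and a prime `𝔮 ∋ π`: there is
  `r ∉ 𝔮` with `N[1/r]` free over `B[1/r]` (localise at `𝔮`, apply the criterion, a finite flat module
  over a local ring is free, and freeness spreads to a basic open neighbourhood for finitely
  presented modules, Mathlib `Module.FinitePresentation.exists_free_localizedModule_powers`).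

Everything is proved; no definitions.
-/

-- `Summit.HodgeConjecture.HodgeConjecture.…` repeats the summit name by the D-0017 layout (Sub = Summit).
set_option linter.dupNamespace false

universe u v

open TensorProduct

namespace Summit.HodgeConjecture.HodgeConjecture.Theorems.FormalVectorBundlesAlgebraize

open Literature.RingTheory.Flat

variable {R : Type u} [CommRing R] {N : Type v} [AddCommGroup N] [Module R N]

/-- **Matsumura, Thm. 22.3 (β), (5) ⇒ (1), ideal-separated form.** Let `R` be Noetherian, `J` an
ideal and `N` an `R`-module with `⋂ₖ Jᵏ(N ⊗ 𝔞) = 0` for every ideal `𝔞`. If `N/J^{n+1}N` is flat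
over `R/J^{n+1}` for every `n`, then `N` is flat over `R`: for `x` in the kernel of `N ⊗ 𝔞 → N`, its
image in `N ⊗ (𝔞 + Jⁿ)/Jⁿ` vanishes because `N ⊗ (𝔞 + Jⁿ)/Jⁿ → N ⊗ R/Jⁿ` is injective by the
flatness of `N/JⁿN` over `R/Jⁿ`, so `x` comes from `N ⊗ (𝔞 ∩ Jⁿ) ⊆ J^{n-c-1}(N ⊗ 𝔞)` by Artin–Rees;
hence `x ∈ ⋂ₖ Jᵏ(N ⊗ 𝔞) = 0`. -/
theorem flat_of_flat_quotient_powers [IsNoetherianRing R] (J : Ideal R)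
    (hsep : ∀ I : Ideal R, (⨅ k : ℕ, J ^ k • ⊤ : Submodule R (N ⊗[R] ↥I)) = ⊥)
    (hflat : ∀ n : ℕ, Module.Flat (R ⧸ J ^ (n + 1)) ((R ⧸ J ^ (n + 1)) ⊗[R] N)) :
    Module.Flat R N := by
  classical
  rw [Module.Flat.iff_lTensor_injective']
  intro I
  rw [← LinearMap.ker_eq_bot, Submodule.eq_bot_iff]
  intro x hx
  rw [LinearMap.mem_ker] at hx
  -- Artin–Rees for `I ⊆ R` and the `J`-adic filtration
  obtain ⟨c, hc⟩ := Ideal.exists_pow_inf_eq_pow_smul J (I : Submodule R R)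
  have hAR : ∀ k : ℕ, ∀ a : R, a ∈ I → a ∈ J ^ (k + c + 1) → a ∈ J ^ k • I := by
    intro k a haI haJ
    have h1 : a ∈ J ^ (k + c + 1) • (⊤ : Submodule R R) ⊓ I := by
      refine ⟨?_, haI⟩
      rw [Ideal.smul_eq_mul, Ideal.mul_top]
      exact haJ
    have hk : k + c + 1 - c = k + 1 := by omega
    rw [hc (k + c + 1) (by omega), hk] at h1
    exact Submodule.smul_mono (Ideal.pow_le_pow_right (Nat.le_succ k)) inf_le_right h1
  -- `x ∈ Jᵏ (N ⊗ I)` for every `k`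
  have hmem : ∀ k : ℕ, x ∈ (J ^ k • ⊤ : Submodule R (N ⊗[R] ↥I)) := by
    intro k
    let Jn : Ideal R := J ^ (k + c + 1)
    haveI : Module.Flat (R ⧸ Jn) ((R ⧸ Jn) ⊗[R] N) := hflat (k + c)
    -- the image `Ī = (I + Jⁿ)/Jⁿ` of `I` in `R/Jⁿ`, `n = k + c + 1`
    let mk : R →ₗ[R] R ⧸ Jn := (Ideal.Quotient.mkₐ R Jn).toLinearMap
    let Ibar' : Ideal (R ⧸ Jn) := I.map (Ideal.Quotient.mk Jn)
    let Ibar : Submodule R (R ⧸ Jn) := Ibar'.restrictScalars R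
    let ρ : ↥I →ₗ[R] ↥Ibar :=
      (mk ∘ₗ I.subtype).codRestrict _ fun a => Ideal.mem_map_of_mem (Ideal.Quotient.mk Jn) a.2
    let ι : ↥(I ⊓ Jn) →ₗ[R] ↥I := Submodule.inclusion inf_le_left
    have hρ0 : ∀ a : ↥I, ρ a = 0 ↔ (a : R) ∈ Jn := fun a => by
      rw [← Ideal.Quotient.eq_zero_iff_mem]
      constructor
      · intro h0
        exact congrArg Subtype.val h0
      · intro h0
        exact Subtype.ext h0
    have hιρ : Function.Exact ι ρ := by
      intro a
      rw [hρ0]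
      constructor
      · intro h0
        exact ⟨⟨(a : R), a.2, h0⟩, rfl⟩
      · rintro ⟨l, rfl⟩
        exact l.2.2
    have hρ : Function.Surjective ρ := by
      rintro ⟨z, hz⟩
      obtain ⟨a, ha, rfl⟩ :=
        (Ideal.mem_map_iff_of_surjective (Ideal.Quotient.mk Jn) Ideal.Quotient.mk_surjective).mp hz
      exact ⟨⟨a, ha⟩, rfl⟩
    -- `N ⊗ Ī → N ⊗ R/Jⁿ` is injective: `N/JⁿN` is flat over `R/Jⁿ`
    have hinj : Function.Injective (LinearMap.lTensor N Ibar.subtype) :=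
      lTensor_injective_of_flat_baseChange (R := R) (N := N) (S := R ⧸ Jn) Ibar'
    -- chase: `x ↦ 0` in `N ⊗ Ī`, so `x` comes from `N ⊗ (I ∩ Jⁿ)`
    have hcomm : Ibar.subtype ∘ₗ ρ = mk ∘ₗ I.subtype := rfl
    have h1 : LinearMap.lTensor N Ibar.subtype (LinearMap.lTensor N ρ x) = 0 := by
      rw [← LinearMap.comp_apply, ← LinearMap.lTensor_comp, hcomm, LinearMap.lTensor_comp,
        LinearMap.comp_apply, hx, map_zero]
    have h2 : LinearMap.lTensor N ρ x = 0 := hinj (by rw [h1, map_zero])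
    obtain ⟨y, hy⟩ := ((lTensor_exact N hιρ hρ) x).mp h2
    -- Artin–Rees: the image of `N ⊗ (I ∩ Jⁿ)` lies in `Jᵏ (N ⊗ I)`
    have hrange : ∀ y, LinearMap.lTensor N ι y ∈ (J ^ k • ⊤ : Submodule R (N ⊗[R] ↥I)) := by
      intro y
      induction y using TensorProduct.induction_on with
      | zero => rw [map_zero]; exact Submodule.zero_mem _
      | add y z hy hz => rw [map_add]; exact Submodule.add_mem _ hy hz
      | tmul m l =>
        rw [LinearMap.lTensor_tmul]
        have hl : ι l ∈ (J ^ k • ⊤ : Submodule R ↥I) := by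
          rw [Submodule.mem_smul_top_iff]
          exact hAR k l l.2.1 l.2.2
        have hT : (TensorProduct.mk R N ↥I m) (ι l) ∈
            Submodule.map (TensorProduct.mk R N ↥I m) (J ^ k • ⊤) := Submodule.mem_map_of_mem hl
        rw [Submodule.map_smul''] at hT
        exact Submodule.smul_mono le_rfl le_top hT
    rw [← hy]
    exact hrange y
  -- conclude by separatedness
  have hx0 : x ∈ (⨅ k : ℕ, J ^ k • ⊤ : Submodule R (N ⊗[R] ↥I)) :=
    (Submodule.mem_iInf _).mpr hmem
  rwa [hsep I, Submodule.mem_bot] at hx0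

/-- **Matsumura, Thm. 22.3 (β), (5) ⇒ (1)** for a finite module over a Noetherian ring and an ideal
`J ⊆ rad R`: if `N/J^{n+1}N` is flat over `R/J^{n+1}` for every `n` then `N` is flat over `R`
(`N ⊗ 𝔞` is a finite module, so it is `J`-adically separated by Krull's intersection theorem,
Mathlib `Ideal.iInf_pow_smul_eq_bot_of_le_jacobson`). -/
theorem flat_of_flat_quotient_powers_of_le_jacobson [IsNoetherianRing R] [Module.Finite R N]
    (J : Ideal R) (hJ : J ≤ (⊥ : Ideal R).jacobson)
    (hflat : ∀ n : ℕ, Module.Flat (R ⧸ J ^ (n + 1)) ((R ⧸ J ^ (n + 1)) ⊗[R] N)) :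
    Module.Flat R N :=
  flat_of_flat_quotient_powers J (fun _ => Ideal.iInf_pow_smul_eq_bot_of_le_jacobson J hJ) hflat

/-- **Base change of the truncation hypothesis to the local ring.** For `B → R` an algebra map,
`π ∈ B`, `J = (π)R`, and `N_R` the base change of `N` to `R` (e.g. a localisation), flatness of
`N/π^{n+1}N` over `B/π^{n+1}` gives flatness of `N_R/J^{n+1}N_R` over `R/J^{n+1}`
(`R/J^{n+1}` is a `B/π^{n+1}`-algebra and `R/J^{n+1} ⊗_R N_R = R/J^{n+1} ⊗_B N`). -/
theorem flat_quotient_pow_baseChange {B : Type u} [CommRing B] (π : B)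
    {N : Type v} [AddCommGroup N] [Module B N]
    (R : Type u) [CommRing R] [Algebra B R] {NR : Type v} [AddCommGroup NR] [Module B NR]
    [Module R NR] [IsScalarTower B R NR] {f : N →ₗ[B] NR} (hf : IsBaseChange R f) (n : ℕ)
    [Module.Flat (B ⧸ Ideal.span {π} ^ (n + 1)) ((B ⧸ Ideal.span {π} ^ (n + 1)) ⊗[B] N)] :
    Module.Flat (R ⧸ Ideal.span {algebraMap B R π} ^ (n + 1))
      ((R ⧸ Ideal.span {algebraMap B R π} ^ (n + 1)) ⊗[R] NR) := by
  set J : Ideal R := Ideal.span {algebraMap B R π} with hJdef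
  set S := B ⧸ Ideal.span {π} ^ (n + 1)
  set T := R ⧸ J ^ (n + 1)
  have hle : Ideal.span {π} ^ (n + 1) ≤ (J ^ (n + 1)).comap (algebraMap B R) := by
    rw [← Ideal.map_le_iff_le_comap, Ideal.map_pow, Ideal.map_span, Set.image_singleton]
  letI : Algebra S T := (Ideal.quotientMap (J ^ (n + 1)) (algebraMap B R) hle).toAlgebra
  haveI : IsScalarTower B S T := IsScalarTower.of_algebraMap_eq fun b => rfl
  haveI : Module.Flat T (T ⊗[S] (S ⊗[B] N)) := inferInstance
  have e₁ : T ⊗[S] (S ⊗[B] N) ≃ₗ[T] T ⊗[B] N :=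
    TensorProduct.AlgebraTensorModule.cancelBaseChange B S T T N
  have e₂ : T ⊗[R] (R ⊗[B] N) ≃ₗ[T] T ⊗[B] N :=
    TensorProduct.AlgebraTensorModule.cancelBaseChange B R T T N
  have e₃ : T ⊗[R] (R ⊗[B] N) ≃ₗ[T] T ⊗[R] NR :=
    TensorProduct.AlgebraTensorModule.congr (LinearEquiv.refl T T) hf.equiv
  exact Module.Flat.of_linearEquiv (e₃.symm ≪≫ₗ e₂ ≪≫ₗ e₁.symm)

/-- **The algebra core of Görtz–Wedhorn II, Prop. 24.95.** Let `B` be Noetherian, `π ∈ B`, `N` a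
finitely presented `B`-module such that `N/π^{n+1}N` is flat over `B/π^{n+1}` for every `n`, and
`𝔮` a prime ideal containing `π`. Then `N[1/r]` is free over `B[1/r]` for some `r ∉ 𝔮`: the
localisation `N_𝔮` satisfies the same truncation hypothesis over the Noetherian local ring `B_𝔮`
with `π ∈ 𝔮B_𝔮 = rad B_𝔮`, so it is flat by the local criterion
(`flat_of_flat_quotient_powers_of_le_jacobson`), hence free (finite flat over a local ring), and
freeness at `𝔮` spreads to a basic open neighbourhood for finitely presented modules (Mathlib
`Module.FinitePresentation.exists_free_localizedModule_powers`). -/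
theorem exists_free_localizedModule_of_flat_quotient_powers {B : Type u} [CommRing B]
    [IsNoetherianRing B] (π : B) (N : Type u) [AddCommGroup N] [Module B N]
    [Module.FinitePresentation B N]
    (hflat : ∀ n : ℕ, Module.Flat (B ⧸ Ideal.span {π} ^ (n + 1))
      ((B ⧸ Ideal.span {π} ^ (n + 1)) ⊗[B] N))
    (𝔮 : Ideal B) [𝔮.IsPrime] (hπ : π ∈ 𝔮) :
    ∃ r : B, r ∉ 𝔮 ∧ Module.Free (Localization.Away r) (LocalizedModule.Away r N) := by
  let R := Localization.AtPrime 𝔮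
  let f := LocalizedModule.mkLinearMap 𝔮.primeCompl N
  have hbc : IsBaseChange R f := IsLocalizedModule.isBaseChange 𝔮.primeCompl R f
  let J : Ideal R := Ideal.span {algebraMap B R π}
  have hJ : J ≤ (⊥ : Ideal R).jacobson := by
    rw [IsLocalRing.jacobson_eq_maximalIdeal ⊥ bot_ne_top, Ideal.span_le,
      Set.singleton_subset_iff]
    exact (IsLocalization.AtPrime.to_map_mem_maximal_iff R 𝔮 π).mpr hπ
  have hflatR : ∀ n : ℕ, Module.Flat (R ⧸ J ^ (n + 1))
      ((R ⧸ J ^ (n + 1)) ⊗[R] LocalizedModule 𝔮.primeCompl N) := by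
    intro n
    haveI := hflat n
    exact flat_quotient_pow_baseChange π R hbc n
  haveI : Module.Flat R (LocalizedModule 𝔮.primeCompl N) :=
    flat_of_flat_quotient_powers_of_le_jacobson J hJ hflatR
  haveI : Module.Free R (LocalizedModule 𝔮.primeCompl N) := Module.free_of_flat_of_isLocalRing
  obtain ⟨r, hr, hfree, -⟩ :=
    Module.FinitePresentation.exists_free_localizedModule_powers 𝔮.primeCompl f R
  exact ⟨r, hr, hfree⟩


/-- **Registered sub-goal** (helper stub of `stub_formallyFreeCokernel`, universe `0`): the algebra
core `exists_free_localizedModule_of_flat_quotient_powers`. -/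
theorem stub_ffcAlgebraCore :
  ∀ (B : Type) [CommRing B] [IsNoetherianRing B] (π : B) (N : Type) [AddCommGroup N] [Module B N] [Module.FinitePresentation B N], (∀ n : ℕ, Module.Flat (B ⧸ Ideal.span {π} ^ (n + 1)) (TensorProduct B (B ⧸ Ideal.span {π} ^ (n + 1)) N)) → ∀ (𝔮 : Ideal B) [𝔮.IsPrime], π ∈ 𝔮 → ∃ r : B, r ∉ 𝔮 ∧ Module.Free (Localization.Away r) (LocalizedModule.Away r N) :=
  fun _ _ _ π N _ _ _ h 𝔮 _ hπ => exists_free_localizedModule_of_flat_quotient_powers π N h 𝔮 hπ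

end Summit.HodgeConjecture.HodgeConjecture.Theorems.FormalVectorBundlesAlgebraize
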